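import Summits.QuantumFields.YangMills.Theorems.SwapVirialDeficitBlowUpGnomonicFollowerWeightMass
import Summits.QuantumFields.YangMills.Theorems.SwapVirialDeficitBlowUpGnomonicDeficitDefs
import HarnessLib

/-!
# THE FOLLOWER FIBRE INTEGRAL IN T1's LETTERS — step (1) of LEAD g99's memo11c for N2 of `stub_end_gaussCore`
# (free-hands support of ⟨stmt-QuantumFields-24197⟩ `SwapVirialDeficit.SwapGluedStiffness`)

w3 g67's `hN2` socket (✓`endGauss_slab_le_of_N2`) integrates over the follower block `F : Fol L → ℝ³` of the gnomonic letters with the weight `piWeight F`; w2 g60's follower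
Laplace ceiling ✓`follower_laplace_ceiling` (T1) integrates over `y : V_F = GnoFol L` with `piWeight (gnoFolBlocks y)` and the deficit at `η + gnoFolEmb y`.  This file is the
change of letters between the two (w2's volume-preserving ✓`gnoFolBlocksEquiv`, ✓`gnoFolEmb_apply`):
* `leaders_add_gnoFolEmb` : `((x, y), (z, 0)) + gnoFolEmb f = ((x, y), (z, gnoFolBlocks f))`;
* ★ `integral_follower_exp_eq_gnoFol` (Bochner) and ★ `lintegral_follower_exp_eq_gnoFol` (`ℝ≥0∞`): for every hub `a`, signs `ε`, leaders `(x, y, z)` and `b`,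
  `∫⁻ F, ofReal(piWeight F · e^{−bF̂(a,ε,((x,y),(z,F)))}) = ofReal(∫ f : V_F, e^{−bF̂(a,ε,((x,y),(z,0)) + gnoFolEmb f)} · piWeight(gnoFolBlocks f))`;
* `integrable_follower_exp_gnoFol` (the T1 integrand is integrable: bounded by `piWeight`, ✓`integral_piWeight_gnoFolBlocks`).

HONEST LABEL: bookkeeping; `stub_end_gaussCore` (N2, shell side, final plug), `stub_core_tip`, ⟨24197⟩ ∕ ⟨24194⟩ OPEN; own crux ⟨22884⟩ `LargeFieldMassRefinementTail` OPEN
(blocked-on ⟨19935⟩); the Yang–Mills mass gap is NOT proved; no summit is proved by a line.  THEOREMS ONLY (0 `def`, 0 `sorry`, no instance), standard axioms.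
LEAD seat ym-line-sfw-p2 g99 (cell ym-idea-1, free hands), `--supports stmt-QuantumFields-24197`.  References: [folklore].
-/

set_option autoImplicit false
set_option synthInstance.maxSize 1024

noncomputable section

open MeasureTheory Quaternion Set
open scoped Quaternion BigOperators ENNReal
open Literature.MathematicalPhysics.QuantumLattice
open Literature.MathematicalPhysics.QuantumFieldTheory hiding SU2

namespace Summit.QuantumFields.YangMills.Theorems.SwapVirialDeficit.BlowUpRing

open Summit.QuantumFields.YangMills.Theorems.FemtoTransferGap
open Summit.QuantumFields.YangMills.Theorems.FemtoTransferGap.TT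
open Summit.QuantumFields.YangMills.Theorems.SwapVirialDeficit.Gnomonic (gnomonicWeight piWeight piWeight_pos piWeight_le_one integrable_piWeight continuous_piWeight)

variable {L : ℕ} [NeZero L]

/-- `((x, y), (z, 0)) + gnoFolEmb f = ((x, y), (z, gnoFolBlocks f))` (✓`gnoFolEmb_apply`). [folklore] -/
theorem leaders_add_gnoFolEmb (x y z : Fin 3 → ℝ) (f : GnoFol L) :
    (((x, y), (z, (0 : Fol L → Fin 3 → ℝ))) : GnoCoord L) + gnoFolEmb f = (((x, y), (z, gnoFolBlocks f)) : GnoCoord L) := by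
  rw [gnoFolEmb_apply]
  ext <;> simp

/-- The T1 integrand `f ↦ e^{−bF̂(a, ε, η + gnoFolEmb f)}·piWeight(gnoFolBlocks f)` is integrable on `V_F` for `b ≥ 0` (bounded by the integrable follower weight). [folklore] -/
theorem integrable_follower_exp_gnoFol (z₁ : Fin 3 → Bool) (χ : Site 3 L → SU2) (a : ℍ) (ε : GnoSign L) (η : GnoCoord L) {b : ℝ} (hb : 0 ≤ b) :
    Integrable fun f : GnoFol L => Real.exp (-(b * gnoDeficit z₁ χ a ε (η + gnoFolEmb f))) * piWeight (gnoFolBlocks f) := by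
  have hpi : Integrable fun f : GnoFol L => piWeight (gnoFolBlocks f) := by
    have h := (volume_preserving_gnoFolBlocksEquiv (L := L)).integrable_comp_emb (gnoFolBlocksEquiv (L := L)).measurableEmbedding (g := fun F => piWeight F)
    exact h.2 integrable_piWeight
  have hm : AEStronglyMeasurable (fun f : GnoFol L => Real.exp (-(b * gnoDeficit z₁ χ a ε (η + gnoFolEmb f))) * piWeight (gnoFolBlocks f)) volume := by
    refine (Measurable.mul ?_ ?_).aestronglyMeasurable
    · exact (((measurable_gnoDeficit z₁ χ a ε).comp ((gnoFolEmb (L := L)).continuous.measurable.const_add η)).const_mul b).neg.exp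
    · exact continuous_piWeight.measurable.comp (gnoFolBlocksEquiv (L := L)).measurable
  refine hpi.mono' hm (Filter.Eventually.of_forall fun f => ?_)
  have h0 : 0 ≤ piWeight (gnoFolBlocks f) := (piWeight_pos _).le
  have h1 : Real.exp (-(b * gnoDeficit z₁ χ a ε (η + gnoFolEmb f))) ≤ 1 := by
    rw [Real.exp_le_one_iff, neg_nonpos]; exact mul_nonneg hb (gnoDeficit_nonneg _ _ _ _ _)
  rw [Real.norm_eq_abs, abs_of_nonneg (mul_nonneg (Real.exp_pos _).le h0)]
  calc Real.exp (-(b * gnoDeficit z₁ χ a ε (η + gnoFolEmb f))) * piWeight (gnoFolBlocks f) ≤ 1 * piWeight (gnoFolBlocks f) :=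
        mul_le_mul_of_nonneg_right h1 h0
    _ = piWeight (gnoFolBlocks f) := one_mul _

/-- ★ **THE FOLLOWER FIBRE INTEGRAL IN T1's LETTERS** (Bochner): for every hub, signs, leaders `(x, y, z)` and `b`,
`∫_{Fol L → ℝ³} piWeight(F)·e^{−bF̂(a,ε,((x,y),(z,F)))} dF = ∫_{V_F} e^{−bF̂(a,ε,((x,y),(z,0)) + gnoFolEmb f)}·piWeight(gnoFolBlocks f) df`. [folklore] -/
theorem integral_follower_exp_eq_gnoFol (z₁ : Fin 3 → Bool) (χ : Site 3 L → SU2) (a : ℍ) (ε : GnoSign L) (x y z : Fin 3 → ℝ) (b : ℝ) :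
    ∫ F : Fol L → Fin 3 → ℝ, piWeight F * Real.exp (-(b * gnoDeficit z₁ χ a ε (((x, y), (z, F)) : GnoCoord L))) =
      ∫ f : GnoFol L, Real.exp (-(b * gnoDeficit z₁ χ a ε ((((x, y), (z, (0 : Fol L → Fin 3 → ℝ))) : GnoCoord L) + gnoFolEmb f))) * piWeight (gnoFolBlocks f) := by
  have h := (volume_preserving_gnoFolBlocksEquiv (L := L)).integral_comp' (g := fun F : Fol L → Fin 3 → ℝ =>
    piWeight F * Real.exp (-(b * gnoDeficit z₁ χ a ε (((x, y), (z, F)) : GnoCoord L))))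
  rw [← h]
  refine integral_congr_ae (Filter.Eventually.of_forall fun f => ?_)
  simp only [gnoFolBlocksEquiv_apply, leaders_add_gnoFolEmb]
  ring

/-- ★ **THE FOLLOWER FIBRE INTEGRAL IN T1's LETTERS** (`ℝ≥0∞` form, `b ≥ 0`):
`∫⁻ F, ofReal(piWeight F · e^{−bF̂(a,ε,((x,y),(z,F)))}) = ofReal(∫_{V_F} e^{−bF̂(η₀ + gnoFolEmb f)}·piWeight(gnoFolBlocks f) df)`, `η₀ = ((x,y),(z,0))`. [folklore] -/
theorem lintegral_follower_exp_eq_gnoFol (z₁ : Fin 3 → Bool) (χ : Site 3 L → SU2) (a : ℍ) (ε : GnoSign L) (x y z : Fin 3 → ℝ) {b : ℝ} (hb : 0 ≤ b) :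
    ∫⁻ F : Fol L → Fin 3 → ℝ, ENNReal.ofReal (piWeight F * Real.exp (-(b * gnoDeficit z₁ χ a ε (((x, y), (z, F)) : GnoCoord L)))) =
      ENNReal.ofReal (∫ f : GnoFol L, Real.exp (-(b * gnoDeficit z₁ χ a ε ((((x, y), (z, (0 : Fol L → Fin 3 → ℝ))) : GnoCoord L) + gnoFolEmb f))) *
        piWeight (gnoFolBlocks f)) := by
  rw [← integral_follower_exp_eq_gnoFol]
  -- the `F`-integrand is integrable (bounded by `piWeight`)
  have hint : Integrable fun F : Fol L → Fin 3 → ℝ => piWeight F * Real.exp (-(b * gnoDeficit z₁ χ a ε (((x, y), (z, F)) : GnoCoord L))) := by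
    have hm : AEStronglyMeasurable (fun F : Fol L → Fin 3 → ℝ => piWeight F * Real.exp (-(b * gnoDeficit z₁ χ a ε (((x, y), (z, F)) : GnoCoord L)))) volume := by
      refine (continuous_piWeight.measurable.mul ?_).aestronglyMeasurable
      have hF : Measurable fun F : Fol L → Fin 3 → ℝ => (((x, y), (z, F)) : GnoCoord L) := measurable_const.prodMk (measurable_const.prodMk measurable_id)
      exact (((measurable_gnoDeficit z₁ χ a ε).comp hF).const_mul b).neg.exp
    refine (integrable_piWeight (ι := Fol L)).mono' hm (Filter.Eventually.of_forall fun F => ?_)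
    have h0 : 0 ≤ piWeight F := (piWeight_pos _).le
    have h1 : Real.exp (-(b * gnoDeficit z₁ χ a ε (((x, y), (z, F)) : GnoCoord L))) ≤ 1 := by
      rw [Real.exp_le_one_iff, neg_nonpos]; exact mul_nonneg hb (gnoDeficit_nonneg _ _ _ _ _)
    rw [Real.norm_eq_abs, abs_of_nonneg (mul_nonneg h0 (Real.exp_pos _).le)]
    calc piWeight F * Real.exp (-(b * gnoDeficit z₁ χ a ε (((x, y), (z, F)) : GnoCoord L))) ≤ piWeight F * 1 := mul_le_mul_of_nonneg_left h1 h0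
      _ = piWeight F := mul_one _
  exact (ofReal_integral_eq_lintegral_ofReal hint (Filter.Eventually.of_forall fun F => mul_nonneg (piWeight_pos _).le (Real.exp_pos _).le)).symm

end Summit.QuantumFields.YangMills.Theorems.SwapVirialDeficit.BlowUpRing

end
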